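import Summits.QuantumFields.YangMills.Theorems.VirialFluxGapRegularValleyCombBase
import Summits.QuantumFields.YangMills.Theorems.VirialFluxGapFixFrameStd
import Summits.QuantumFields.YangMills.Theorems.VirialFluxGapRingFrameLog
import Summits.QuantumFields.YangMills.Theorems.VirialFluxGapFrameKernelOfFlat
import HarnessLib

/-!
# Route `VirialFluxGap` (YangMills): the GENERIC CHART of `X_fix` at a regular point — the logarithm to the comb base point in `fixFrameStd`

Input (ii) of fcl-p3's master estimates ✓`FrameHessian.generic_drive_lower` ∕ ✓`generic_divergence_upper` ON THE HOST `X_fix` (LEAD ruling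
2026-08-30T23:30Z) for the ⟨stmt-QuantumFields-24141⟩ `PeriodicSoftness` team: at a `ρ`-regular ring history `P` whose slice `0` is in comb
gauge (tree links `= 1`, i.e. a point of the tree-gauged space `X_fix`) with small deficit, the comb base point `p = ((fun _ => combFlat h'),
fun _ => c')` of ✓`exists_comb_near_of_regular_of_treeGauge_eq_one` (data on ONE unit axis) is a multi-direction translate
`p = P·exp(Y_u)`, `Y_u = dirOf fixFrameStd u`, with coordinates `u : FixVar L × Fin 3 → ℝ` in the standard `X_fix` frame
(✓`VirialFluxGapFixFrameStd`) obeying the QUADRATIC GROWTH `|u|² ≤ 1032960·L⁸·F₀(P)/ρ²`: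

* `treeGauge_eq_one_of_tree_links` — tree links `= 1` ⇒ comb gauge;
* `norm_coe_sub_coe_eq_fd` — the Frobenius distance of the slots is w2's `fd`;
* ★★★ `exists_fixChart_of_regular` — the package `(n, th, tc, h', c', u)`: unit axis, comb data on it, `F₀(p) = 0`,
  `P * multiCurve (dirOf fixFrameStd u) 1 = p`, `u ⬝ᵥ u ≤ 1032960·L⁸·F₀(P)/ρ²` — from ✓`exists_comb_near_of_regular_of_treeGauge_eq_one`
  (fd bounds, ✓`constants_arith_far`), fcl-p3's ✓`exists_multiCurve_eq_of_near` (slot logarithms, `‖Y_w‖ ≤ 2‖p_w − P_w‖`), the vanishing of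
  `Y` on the tree links of slice `0` (both `P` and `p` are `1` there), ✓`dirOf_fixFrameStd_fixCoord` and ✓`fixCoord_dot_self_le`.
  Together with ✓∕⧗`FixFrame.exists_four_orthonormal_kernel_vectors` (input (iii), `m = 4`, same `p`, same axis data) this is the complete
  geometric input of the generic chart on `X_fix`; smallness asked: `224·L²·√F₀(P) < ρ`.

HONEST FRAMING: glue between landed files; the constants `K` (fcl-p3's ⧗`exists_bound_frameD3_ringPoly`), `λ`, the cut-offs, the central
charts and the assembly of «EulerFieldFix» are NOT here; ⟨24141⟩ and ⟨22884⟩ stay OPEN; no stub ∕ crux ∕ rung ∕ summit is closed; the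
Yang–Mills mass gap is NOT proved; no summit is proved by a line.  No definitions, 0 `sorry`, standard axioms.  Width seat
`ym-line-sfw-p2-w2` g51 (cell ym-idea-1, free hands), `--supports stmt-QuantumFields-24141`.  References: [cite: Luscher1983, §2], [folklore].
-/

set_option autoImplicit false

noncomputable section

open scoped Quaternion Matrix BigOperators
open Literature.MathematicalPhysics.QuantumFieldTheory hiding SU2
open Literature.MathematicalPhysics.QuantumLattice

namespace Summit.QuantumFields.YangMills.Theorems.VirialFluxGap.FixFrame

open Summit.QuantumFields.YangMills.Theorems.FemtoTransferGap
open Summit.QuantumFields.YangMills.Theorems.FemtoTransferGap.TT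
open Summit.QuantumFields.YangMills.Theorems.FemtoTransferGap.TwoLattice
open Summit.QuantumFields.YangMills.Theorems.FemtoTransferGap.TwoLattice.Flat
open Summit.QuantumFields.YangMills.Theorems.VirialFluxGap.RingDeficit
open Summit.QuantumFields.YangMills.Theorems.VirialFluxGap.FrameDerivative
open Summit.QuantumFields.YangMills.Theorems.VirialFluxGap.FrameHessian
open Summit.QuantumFields.YangMills.Theorems.VirialFluxGap.RegularValley
open Summit.QuantumFields.YangMills.Theorems.ToronValleyVolume.Lojasiewicz

open scoped Matrix.Norms.Frobenius

variable {L : ℕ} [NeZero L]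

/-- A slice whose tree links are `1` is in comb gauge: `treeGauge U = 1`. [folklore] -/
theorem treeGauge_eq_one_of_tree_links {U : GaugeConfig 3 L SU2} (hU : ∀ e : Edge 3 L, treeEdge e = true → U e = 1) : treeGauge U = 1 := by
  funext x
  rw [treeGauge_congr (U' := fun _ : Edge 3 L => (1 : SU2)) hU x, treeGauge_one, Pi.one_apply]

omit [NeZero L] in
/-- The Frobenius distance of two `SU(2)` slots is the chordal distance `fd`. [folklore] -/
theorem norm_coe_sub_coe_eq_fd (V W : SU2) : ‖(W : Matrix (Fin 2) (Fin 2) ℂ) - (V : Matrix (Fin 2) (Fin 2) ℂ)‖ = fd V W := by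
  rw [fd_comm, fd, frobNorm_eq_norm]
set_option maxHeartbeats 400000 in
/-- ★★★ **The generic chart of `X_fix` at a regular point.**  `P` with slice-`0` tree links `= 1`, `ρ`-regular (`0 < ρ`, pivot
`1 − Re² ≥ ρ²` at a wrap representative of slice `0` or at the seam value `P.2 0`), and `224·L²·√F₀(P) < ρ`.  Then there are a unit axis
`(n₁,n₂,n₃)`, comb data `h', c'` on it, and coordinates `u : FixVar L × Fin 3 → ℝ` such that the comb point `p = ((fun _ => combFlat h'),
fun _ => c')` is flat, `P·exp(dirOf fixFrameStd u) = p`, and `|u|² ≤ 1032960·L⁸·F₀(P)/ρ²`. [cite: Luscher1983, §2] -/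
theorem exists_fixChart_of_regular (P : (Fin (2 * L - 1 + 1) → GaugeConfig 3 L SU2) × (Site 3 L → SU2))
    (hP : ∀ e : Edge 3 L, treeEdge e = true → P.1 0 e = 1) {ρ : ℝ} (hρ : 0 < ρ)
    (hfar : (∃ k : Fin 3, ρ ^ 2 ≤ 1 - (su2Quat (wrapReps (P.1 0) k)).re ^ 2) ∨ ρ ^ 2 ≤ 1 - (su2Quat (P.2 0)).re ^ 2)
    (hsmall : 224 * (L : ℝ) ^ 2 * Real.sqrt (ringDeficit L (fun _ => false) P) < ρ) :
    ∃ (n₁ n₂ n₃ : ℝ) (th : Fin 3 → ℝ) (tc : ℝ) (h' : Fin 3 → SU2) (c' : SU2) (u : FixVar L × Fin 3 → ℝ),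
      n₁ ^ 2 + n₂ ^ 2 + n₃ ^ 2 = 1 ∧
      (∀ j, (su2Quat (h' j)).imI = th j * n₁ ∧ (su2Quat (h' j)).imJ = th j * n₂ ∧ (su2Quat (h' j)).imK = th j * n₃) ∧
      ((su2Quat c').imI = tc * n₁ ∧ (su2Quat c').imJ = tc * n₂ ∧ (su2Quat c').imK = tc * n₃) ∧
      ringDeficit L (fun _ => false) (((fun _ => combFlat h'), fun _ => c') : (Fin (2 * L - 1 + 1) → GaugeConfig 3 L SU2) × (Site 3 L → SU2)) = 0 ∧
      P * multiCurve (dirOf (fixFrameStd (L := L)) u) (dirOf_conjTranspose fixFrameStd_conjTranspose u) (dirOf_trace fixFrameStd_trace u) 1 =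
        (((fun _ => combFlat h'), fun _ => c') : (Fin (2 * L - 1 + 1) → GaugeConfig 3 L SU2) × (Site 3 L → SU2)) ∧
      u ⬝ᵥ u ≤ 1032960 * (L : ℝ) ^ 8 * ringDeficit L (fun _ => false) P / ρ ^ 2 := by
  set ε := ringDeficit L (fun _ => false) P with hε
  have hε0 : 0 ≤ ε := ringDeficit_nonneg _ _
  set δ := Real.sqrt ε with hδ
  have hδ0 : 0 ≤ δ := Real.sqrt_nonneg _
  have hδ2 : δ ^ 2 = ε := Real.sq_sqrt hε0
  have hL1 : (1 : ℝ) ≤ L := by exact_mod_cast NeZero.one_le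
  have hρ1 : ρ ≤ 1 := by
    have hρ2 : ρ ^ 2 ≤ 1 := by
      rcases hfar with ⟨k, hk⟩ | h0
      · nlinarith [sq_nonneg (su2Quat (wrapReps (P.1 0) k)).re]
      · nlinarith [sq_nonneg (su2Quat (P.2 0)).re]
    nlinarith
  have ht : treeGauge (P.1 0) = 1 := treeGauge_eq_one_of_tree_links hP
  obtain ⟨n₁, n₂, n₃, th, tc, h', c', hn, hh', hc', hQ0, hQ1, hQ2, -⟩ := exists_comb_near_of_regular_of_treeGauge_eq_one P ht hρ hfar
  set B₁ := 4 * (L : ℝ) * δ + 12 * (L : ℝ) ^ 2 * δ + 40 * (L : ℝ) ^ 2 * δ / ρ with hB₁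
  set B₂ := 12 * (L : ℝ) ^ 2 * δ + 40 * (L : ℝ) ^ 2 * δ / ρ with hB₂
  have hB₂₁ : B₂ ≤ B₁ := by rw [hB₁, hB₂]; nlinarith
  -- smallness: `B₁ ≤ 56 L² δ / ρ < 1/4`
  have hB₁lt : B₁ < 1 / 4 := by
    have h56 : B₁ ≤ 56 * (L : ℝ) ^ 2 * δ / ρ := by
      rw [hB₁, div_eq_mul_inv, div_eq_mul_inv]
      have hρi : 1 ≤ ρ⁻¹ := one_le_inv_iff₀.2 ⟨hρ, hρ1⟩
      have h1 : 4 * (L : ℝ) * δ ≤ 4 * (L : ℝ) ^ 2 * δ * ρ⁻¹ := by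
        have : 4 * (L : ℝ) * δ ≤ 4 * (L : ℝ) ^ 2 * δ := by nlinarith
        nlinarith [mul_le_mul_of_nonneg_left hρi (show 0 ≤ 4 * (L : ℝ) ^ 2 * δ by positivity)]
      have h2 : 12 * (L : ℝ) ^ 2 * δ ≤ 12 * (L : ℝ) ^ 2 * δ * ρ⁻¹ := by
        nlinarith [mul_le_mul_of_nonneg_left hρi (show 0 ≤ 12 * (L : ℝ) ^ 2 * δ by positivity)]
      nlinarith
    have h' : 56 * (L : ℝ) ^ 2 * δ / ρ < 1 / 4 := by
      rw [div_lt_iff₀ hρ]; linarith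
    linarith
  set Q : (Fin (2 * L - 1 + 1) → GaugeConfig 3 L SU2) × (Site 3 L → SU2) := ((fun _ => combFlat h'), fun _ => c') with hQ
  -- the slots are `1/4`-close
  have hnear1 : ∀ (i : Fin (2 * L - 1 + 1)) (e : Edge 3 L),
      ‖(Q.1 i e : Matrix (Fin 2) (Fin 2) ℂ) - (P.1 i e : Matrix (Fin 2) (Fin 2) ℂ)‖ < 1 / 4 := fun i e => by
    rw [norm_coe_sub_coe_eq_fd]
    exact (hQ1 i e).trans_lt hB₁lt
  have hnear2 : ∀ x : Site 3 L, ‖(Q.2 x : Matrix (Fin 2) (Fin 2) ℂ) - (P.2 x : Matrix (Fin 2) (Fin 2) ℂ)‖ < 1 / 4 := fun x => by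
    rw [norm_coe_sub_coe_eq_fd]
    exact (hQ2 x).trans_lt (hB₂₁.trans_lt hB₁lt)
  obtain ⟨Y, hY, hY0, hPQ, hY1, hY2⟩ := exists_multiCurve_eq_of_near P Q hnear1 hnear2
  -- `Y` vanishes on the tree links of slice `0`
  have hYtree : ∀ e : Edge 3 L, treeEdge e = true → Y (Sum.inl (0, e)) = 0 := fun e he => by
    have h := hY1 0 e
    have hQe : Q.1 0 e = 1 := by
      show combFlat h' e = 1
      rw [combFlat_apply, if_neg (fun h => not_treeEdge_of_wrap h he)]
    rw [hQe, hP e he, sub_self, norm_zero, mul_zero] at h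
    exact norm_le_zero_iff.1 h
  refine ⟨n₁, n₂, n₃, th, tc, h', c', fixCoord Y, hn, hh', hc', hQ0, ?_, ?_⟩
  · -- the translate
    rw [multiCurve_congr _ _ hY hY0 (dirOf_fixFrameStd_fixCoord hY hY0 hYtree) 1]
    exact hPQ
  · -- quadratic growth
    have hcardI : (Fintype.card (Fin (2 * L - 1 + 1)) : ℝ) = 2 * (L : ℝ) := by
      rw [Fintype.card_fin]
      have hL : 1 ≤ L := NeZero.one_le
      rw [show 2 * L - 1 + 1 = 2 * L by omega]; push_cast; ring
    have hcardS : (Fintype.card (Site 3 L) : ℝ) = (L : ℝ) ^ 3 := by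
      rw [Fintype.card_pi, Finset.prod_const, Finset.card_univ, Fintype.card_fin, ZMod.card]; push_cast; ring
    have hY1' : ∀ (i : Fin (2 * L - 1 + 1)) (e : Edge 3 L), ‖Y (Sum.inl (i, e))‖ ≤ 2 * fd (P.1 i e) (combFlat h' e) := fun i e => by
      have h := hY1 i e
      rw [norm_coe_sub_coe_eq_fd] at h
      exact h
    have hY2' : ∀ x : Site 3 L, ‖Y (Sum.inr x)‖ ≤ 2 * fd (P.2 x) c' := fun x => by
      have h := hY2 x
      rw [norm_coe_sub_coe_eq_fd] at h
      exact h
    have hs1 : ∀ (i : Fin (2 * L - 1 + 1)) (e : Edge 3 L), ‖Y (Sum.inl (i, e))‖ ^ 2 ≤ 4 * B₁ ^ 2 := fun i e => by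
      have h2 : ‖Y (Sum.inl (i, e))‖ ≤ 2 * B₁ := (hY1' i e).trans (by linarith [hQ1 i e])
      calc ‖Y (Sum.inl (i, e))‖ ^ 2 ≤ (2 * B₁) ^ 2 := pow_le_pow_left₀ (norm_nonneg _) h2 2
        _ = 4 * B₁ ^ 2 := by ring
    have hs2 : ∀ x : Site 3 L, ‖Y (Sum.inr x)‖ ^ 2 ≤ 4 * B₂ ^ 2 := fun x => by
      have h2 : ‖Y (Sum.inr x)‖ ≤ 2 * B₂ := (hY2' x).trans (by linarith [hQ2 x])
      calc ‖Y (Sum.inr x)‖ ^ 2 ≤ (2 * B₂) ^ 2 := pow_le_pow_left₀ (norm_nonneg _) h2 2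
        _ = 4 * B₂ ^ 2 := by ring
    have hA : (∑ i : Fin (2 * L - 1 + 1), ∑ e : Edge 3 L, ‖Y (Sum.inl (i, e))‖ ^ 2) ≤ 2 * (L : ℝ) * (3 * (L : ℝ) ^ 3 * (4 * B₁ ^ 2)) := by
      have hin : ∀ i : Fin (2 * L - 1 + 1), ∑ e : Edge 3 L, ‖Y (Sum.inl (i, e))‖ ^ 2 ≤ 3 * (L : ℝ) ^ 3 * (4 * B₁ ^ 2) := fun i =>
        calc ∑ e : Edge 3 L, ‖Y (Sum.inl (i, e))‖ ^ 2 ≤ ∑ _e : Edge 3 L, 4 * B₁ ^ 2 := Finset.sum_le_sum fun e _ => hs1 i e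
          _ = 3 * (L : ℝ) ^ 3 * (4 * B₁ ^ 2) := by rw [Finset.sum_const, Finset.card_univ, nsmul_eq_mul, ConstTube.card_edge_three L]
      calc (∑ i : Fin (2 * L - 1 + 1), ∑ e : Edge 3 L, ‖Y (Sum.inl (i, e))‖ ^ 2) ≤ ∑ _i : Fin (2 * L - 1 + 1), 3 * (L : ℝ) ^ 3 * (4 * B₁ ^ 2) :=
            Finset.sum_le_sum fun i _ => hin i
        _ = 2 * (L : ℝ) * (3 * (L : ℝ) ^ 3 * (4 * B₁ ^ 2)) := by rw [Finset.sum_const, Finset.card_univ, nsmul_eq_mul, hcardI]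
    have hB : ∑ x : Site 3 L, ‖Y (Sum.inr x)‖ ^ 2 ≤ (L : ℝ) ^ 3 * (4 * B₂ ^ 2) := by
      calc ∑ x : Site 3 L, ‖Y (Sum.inr x)‖ ^ 2 ≤ ∑ _x : Site 3 L, 4 * B₂ ^ 2 := Finset.sum_le_sum fun x _ => hs2 x
        _ = (L : ℝ) ^ 3 * (4 * B₂ ^ 2) := by rw [Finset.sum_const, Finset.card_univ, nsmul_eq_mul, hcardS]
    have hsplit : ∑ w : ((Fin (2 * L - 1 + 1) × Edge 3 L) ⊕ Site 3 L), ‖Y w‖ ^ 2 =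
        (∑ i : Fin (2 * L - 1 + 1), ∑ e : Edge 3 L, ‖Y (Sum.inl (i, e))‖ ^ 2) + ∑ x : Site 3 L, ‖Y (Sum.inr x)‖ ^ 2 := by
      rw [Fintype.sum_sum_type, Fintype.sum_prod_type]
    have harith := constants_arith_far hL1 hδ0 hρ hρ1
    rw [← hB₁, ← hB₂, hδ2] at harith
    have hu := fixCoord_dot_self_le (L := L) Y
    rw [hsplit] at hu
    have htot : (∑ i : Fin (2 * L - 1 + 1), ∑ e : Edge 3 L, ‖Y (Sum.inl (i, e))‖ ^ 2) + ∑ x : Site 3 L, ‖Y (Sum.inr x)‖ ^ 2 ≤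
        4 * (21520 * (L : ℝ) ^ 8 * ε / ρ ^ 2) := by
      have h1 := add_le_add hA hB
      have e : 2 * (L : ℝ) * (3 * (L : ℝ) ^ 3 * (4 * B₁ ^ 2)) + (L : ℝ) ^ 3 * (4 * B₂ ^ 2) =
          4 * (2 * (L : ℝ) * (3 * (L : ℝ) ^ 3) * B₁ ^ 2 + (L : ℝ) ^ 3 * B₂ ^ 2) := by ring
      rw [e] at h1
      exact h1.trans (mul_le_mul_of_nonneg_left harith (by norm_num))
    calc fixCoord (L := L) Y ⬝ᵥ fixCoord (L := L) Y
        ≤ 12 * ((∑ i : Fin (2 * L - 1 + 1), ∑ e : Edge 3 L, ‖Y (Sum.inl (i, e))‖ ^ 2) + ∑ x : Site 3 L, ‖Y (Sum.inr x)‖ ^ 2) := hu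
      _ ≤ 12 * (4 * (21520 * (L : ℝ) ^ 8 * ε / ρ ^ 2)) := by linarith [htot]
      _ = 1032960 * (L : ℝ) ^ 8 * ε / ρ ^ 2 := by ring

end Summit.QuantumFields.YangMills.Theorems.VirialFluxGap.FixFrame

end
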